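import Summits.ResolutionOfSingularities.ResolutionOfSingularities.Theorems.FrobeniusClosingSteerMonomialDensityApprox
import HarnessLib

/-!
# Crux `Steer` (stmt-ResolutionOfSingularities-16345), chain W4.1, NSCᴹ line — habitat lemma (‡ᵇ) **monomial density**
# (res-L0-w41-idea-2 card 3 `far-frame-exit-budget`, HABITAT.md v3 §2″; typer-ready, Theses-free, definition-free)

OURS (campaign `res-hironaka`, rung L ★L-G4, slot W4.1; NOT a statement of the manuscript under review
[claim: Hironaka2017, status: under-review] — nothing of it is used; AI-produced, weaker than expert review).

`monomialDensity`: in a valued field `C` with values in `ℝ≥0`, let `k'` be a trivially valued subfield and `s₁ … s_d`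
nonzero elements with `ℤ`-independent values such that the subfield `k'(s)` is dense in `C`.  Then every intermediate
field `L ⊇ k'` whose value set contains each `v (s i)` is dense in `C`.  (No completeness, no series: rational
approximants, dominant terms, a multiplicative Lipschitz estimate under substitution, a doubling step, archimedean `ℝ≥0`.)
This is the hypothesis `MonomialCompletionDensity` of `HabitatClaim` (idea-2 Sketch-idea-2i §I9) with `[CompleteSpace C]`
dropped. [folklore] OURS.

Authorship: statement & proof res-L0-w41-idea-2 g9 (`L/res-L0-w41-idea-2/FrobeniusClosingSteerMonomialDensity.lean` f6cd398fe3aa92c5),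
filed by res-type-026 per res-L0-w41-plan-1 RULING 97 (no edits beyond hygiene: docstrings added to helper lemmas, and the file SPLIT
at section C/D for the 400-line rule — sections A–C live in `…MonomialDensityApprox`, sections D–E here; names and namespace unchanged).
-/

open scoped NNReal
open MvPolynomial

set_option linter.dupNamespace false

namespace Summit.ResolutionOfSingularities.ResolutionOfSingularities.Cruxes.Steer.MonomialDensity

namespace MonomialDensityProof

variable {C : Type*} [Field C]


/-! ### D. The iteration -/

section Iteration

variable [Valued C ℝ≥0] (k' : Subfield C) {d : ℕ} (s : Fin d → C)

/-- There are nonzero elements of arbitrarily small value (given one `s i`). -/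
theorem exists_small (hs : ∀ i, s i ≠ 0)
    (hind : ∀ n : Fin d → ℤ, (∏ i, Valued.v (s i) ^ (n i)) = 1 → n = 0) (i : Fin d)
    {γ : ℝ≥0} (hγ : 0 < γ) : ∃ w : C, w ≠ 0 ∧ Valued.v w < γ := by
  have h1 : Valued.v (s i) ≠ 1 := by
    intro h
    have h2 := hind (Pi.single i 1) (by
      rw [Finset.prod_eq_single i]
      · simp [h]
      · intro j _ hj
        simp [Pi.single_eq_of_ne hj]
      · simp)
    have h3 := congr_fun h2 i
    simp at h3
  rcases lt_or_gt_of_ne h1 with hlt | hgt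
  · obtain ⟨n, hn⟩ := NNReal.exists_pow_lt_of_lt_one hγ hlt
    exact ⟨s i ^ n, pow_ne_zero _ (hs i), by rwa [map_pow]⟩
  · have hinv : Valued.v (s i)⁻¹ < 1 := by
      rw [map_inv₀]
      exact inv_lt_one_of_one_lt₀ hgt
    obtain ⟨n, hn⟩ := NNReal.exists_pow_lt_of_lt_one hγ hinv
    exact ⟨(s i)⁻¹ ^ n, pow_ne_zero _ (inv_ne_zero (hs i)), by rwa [map_pow]⟩

/-- START: from an element of `L` with the same value as `s i`, density of the monomial
subfield produces an element of `L` strictly close to `s i` (unit adjustment by `k'`). -/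
theorem exists_close_of_same_value (hk : ∀ c ∈ k', c ≠ 0 → Valued.v c = 1)
    (hs : ∀ i, s i ≠ 0)
    (hind : ∀ n : Fin d → ℤ, (∏ i, Valued.v (s i) ^ (n i)) = 1 → n = 0)
    (hT : Dense ((Subfield.closure ((k' : Set C) ∪ Set.range s) : Subfield C) : Set C))
    {L : Subfield C} (hkL : k' ≤ L) (i : Fin d) {a : C} (haL : a ∈ L)
    (ha : Valued.v a = Valued.v (s i)) :
    ∃ a' ∈ L, Valued.v (a' - s i) < Valued.v (s i) := by
  classical
  have hsi : Valued.v (s i) ≠ 0 := (Valuation.ne_zero_iff _).mpr (hs i)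
  have hsi0 : s i ≠ 0 := hs i
  have hu : Valued.v (a / s i) = 1 := by rw [map_div₀, ha, div_self hsi]
  obtain ⟨q, hqT, hq⟩ := exists_approx_of_dense hT (a / s i) (one_ne_zero (α := C))
  rw [map_one] at hq
  have hvq : Valued.v q = 1 := by
    rw [← hu]
    exact Valuation.map_eq_of_sub_lt _ (by rw [hu]; exact hq)
  obtain ⟨Y, Z, hqYZ⟩ := (mem_closure_iff_aeval k' s).mp hqT
  have hz : aeval s Z ≠ 0 := by
    intro h
    rw [h, div_zero] at hqYZ
    rw [hqYZ, map_zero] at hvq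
    exact zero_ne_one hvq
  have hZ : Z ≠ 0 := by
    rintro rfl
    exact hz (map_zero _)
  have hy : aeval s Y ≠ 0 := by
    intro h
    rw [h, zero_div] at hqYZ
    rw [hqYZ, map_zero] at hvq
    exact zero_ne_one hvq
  have hY : Y ≠ 0 := by
    rintro rfl
    exact hy (map_zero _)
  obtain ⟨n₀, hn₀, -, hvalY, htailY⟩ := exists_dominant Valued.v k' s hk hs hind hY
  obtain ⟨m₀, hm₀, -, hvalZ, htailZ⟩ := exists_dominant Valued.v k' s hk hs hind hZ
  have hyz : Valued.v (aeval s Y) = Valued.v (aeval s Z) := by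
    have h1 := hvq
    rw [hqYZ, map_div₀, div_eq_one_iff_eq ((Valuation.ne_zero_iff _).mpr hz)] at h1
    exact h1
  have hnm : n₀ = m₀ :=
    termVal_inj Valued.v s hs hind (by rw [← hvalY, ← hvalZ, hyz])
  rw [← hnm] at hm₀ hvalZ htailZ
  -- the top coefficients
  have hcY : Y.coeff n₀ ≠ 0 := MvPolynomial.mem_support_iff.mp hn₀
  have hcZ : Z.coeff n₀ ≠ 0 := MvPolynomial.mem_support_iff.mp hm₀
  have hcY1 : Valued.v ((Y.coeff n₀ : k') : C) = 1 := v_coeff _ k' hk hcY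
  have hcZ1 : Valued.v ((Z.coeff n₀ : k') : C) = 1 := v_coeff _ k' hk hcZ
  have hcY0 : ((Y.coeff n₀ : k') : C) ≠ 0 := by simpa using hcY
  have hcZ0 : ((Z.coeff n₀ : k') : C) ≠ 0 := by simpa using hcZ
  set cY : C := ((Y.coeff n₀ : k') : C) with hcYdef
  set cZ : C := ((Z.coeff n₀ : k') : C) with hcZdef
  have hc_mem : cY / cZ ∈ L := div_mem (hkL (Y.coeff n₀).2) (hkL (Z.coeff n₀).2)
  have hc1 : Valued.v (cY / cZ) = 1 := by rw [map_div₀, hcY1, hcZ1, div_one]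
  have hc0 : cY / cZ ≠ 0 := div_ne_zero hcY0 hcZ0
  -- `q` is close to the constant `cY / cZ`
  have hqc : Valued.v (q - cY / cZ) < 1 := by
    have hN : aeval s Y * cZ - aeval s Z * cY =
        cZ * (aeval s Y - cY * ∏ i, s i ^ (n₀ i)) - cY * (aeval s Z - cZ * ∏ i, s i ^ (n₀ i)) := by
      ring
    have hnum : Valued.v (cZ * (aeval s Y - cY * ∏ i, s i ^ (n₀ i)) -
        cY * (aeval s Z - cZ * ∏ i, s i ^ (n₀ i))) < ∏ i, Valued.v (s i) ^ (n₀ i) := by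
      refine Valuation.map_sub_lt _ ?_ ?_
      · rw [map_mul, hcZ1, one_mul]
        exact htailY
      · rw [map_mul, hcY1, one_mul]
        exact htailZ
    have hden : Valued.v (aeval s Z * cZ) = ∏ i, Valued.v (s i) ^ (n₀ i) := by
      rw [map_mul, hcZ1, mul_one, hvalZ]
    rw [hqYZ, div_sub_div _ _ hz hcZ0, map_div₀, hN, hden,
      div_lt_one₀ (pos_iff_ne_zero.mpr (termVal_ne_zero Valued.v s hs n₀))]
    exact hnum
  have huc : Valued.v (a / s i - cY / cZ) < 1 := by
    have h1 : a / s i - cY / cZ = (q - cY / cZ) - (q - a / s i) := by ring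
    rw [h1]
    exact Valuation.map_sub_lt _ hqc hq
  refine ⟨a / (cY / cZ), div_mem haL hc_mem, ?_⟩
  have hid : a / (cY / cZ) - s i = (a / s i - cY / cZ) * s i / (cY / cZ) := by
    rw [sub_mul, div_mul_cancel₀ a hsi0, sub_div, mul_div_cancel_left₀ (s i) hc0]
  rw [hid, map_div₀, hc1, div_one, map_mul]
  exact mul_lt_of_lt_one_left ((Valuation.pos_iff _).mpr (hs i)) huc

/-- STEP: the doubling `P ρ → P ρ²`. -/
theorem step (hk : ∀ c ∈ k', c ≠ 0 → Valued.v c = 1) (hs : ∀ i, s i ≠ 0)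
    (hind : ∀ n : Fin d → ℤ, (∏ i, Valued.v (s i) ^ (n i)) = 1 → n = 0)
    (hT : Dense ((Subfield.closure ((k' : Set C) ∪ Set.range s) : Subfield C) : Set C))
    {L : Subfield C} (hkL : k' ≤ L) {ρ : ℝ≥0} (hρ : ρ < 1)
    (hP : ∀ i, ∃ a ∈ L, Valued.v (a - s i) ≤ ρ * Valued.v (s i)) :
    ∀ i, ∃ a ∈ L, Valued.v (a - s i) ≤ ρ ^ 2 * Valued.v (s i) := by
  classical
  choose a haL haρ using hP
  intro i
  by_cases hcase : Valued.v (a i - s i) ≤ ρ ^ 2 * Valued.v (s i)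
  · exact ⟨a i, haL i, hcase⟩
  push Not at hcase
  have hsi : 0 < Valued.v (s i) := (Valuation.pos_iff _).mpr (hs i)
  have hρ2pos : 0 < ρ ^ 2 * Valued.v (s i) := by
    rcases eq_or_ne ρ 0 with rfl | hρ0
    · exfalso
      have h1 := haρ i
      rw [zero_mul] at h1
      have h0 : Valued.v (a i - s i) = 0 := le_antisymm h1 zero_le
      rw [h0] at hcase
      exact (not_lt.mpr zero_le) hcase
    · exact mul_pos (pow_pos (pos_iff_ne_zero.mpr hρ0) 2) hsi
  obtain ⟨w, hw0, hw⟩ := exists_small s hs hind i hρ2pos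
  obtain ⟨q, hqT, hq⟩ := exists_approx_of_dense hT (a i - s i) hw0
  have hqe : Valued.v q = Valued.v (a i - s i) :=
    Valuation.map_eq_of_sub_lt _ (lt_trans (lt_trans hq hw) hcase)
  obtain ⟨Y, Z, hqYZ⟩ := (mem_closure_iff_aeval k' s).mp hqT
  have hz : aeval s Z ≠ 0 := by
    intro h
    rw [h, div_zero] at hqYZ
    rw [hqYZ, map_zero] at hqe
    rw [← hqe] at hcase
    exact (not_lt.mpr zero_le) hcase
  have hq'L : aeval a Y / aeval a Z ∈ L :=
    div_mem (aeval_mem k' hkL Y fun j => haL j) (aeval_mem k' hkL Z fun j => haL j)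
  have hqq : Valued.v (aeval a Y / aeval a Z - q) ≤ ρ ^ 2 * Valued.v (s i) := by
    rw [hqYZ]
    calc Valued.v (aeval a Y / aeval a Z - aeval s Y / aeval s Z)
        ≤ ρ * Valued.v (aeval s Y / aeval s Z) :=
          approx_div _ hρ hz (approx_aeval _ k' s hk hs hind hρ haρ Y)
            (approx_aeval _ k' s hk hs hind hρ haρ Z)
      _ = ρ * Valued.v (a i - s i) := by rw [← hqYZ, hqe]
      _ ≤ ρ * (ρ * Valued.v (s i)) := mul_le_mul_right (haρ i) _
      _ = ρ ^ 2 * Valued.v (s i) := by ring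
  refine ⟨a i - aeval a Y / aeval a Z, sub_mem (haL i) hq'L, ?_⟩
  have hsplit : a i - aeval a Y / aeval a Z - s i =
      -(aeval a Y / aeval a Z - q) - (q - (a i - s i)) := by ring
  rw [hsplit]
  refine Valuation.map_sub_le _ ?_ ?_
  · rw [Valuation.map_neg]
    exact hqq
  · exact le_of_lt (lt_trans hq hw)

/-- ITERATE: `P ρ → P (ρ ^ 2 ^ m)`. -/
theorem iterate (hk : ∀ c ∈ k', c ≠ 0 → Valued.v c = 1) (hs : ∀ i, s i ≠ 0)
    (hind : ∀ n : Fin d → ℤ, (∏ i, Valued.v (s i) ^ (n i)) = 1 → n = 0)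
    (hT : Dense ((Subfield.closure ((k' : Set C) ∪ Set.range s) : Subfield C) : Set C))
    {L : Subfield C} (hkL : k' ≤ L) {ρ : ℝ≥0} (hρ : ρ < 1)
    (hP : ∀ i, ∃ a ∈ L, Valued.v (a - s i) ≤ ρ * Valued.v (s i)) (m : ℕ) :
    ∀ i, ∃ a ∈ L, Valued.v (a - s i) ≤ ρ ^ (2 ^ m) * Valued.v (s i) := by
  induction m with
  | zero => simpa using hP
  | succ m ih =>
    have hρm : ρ ^ (2 ^ m) < 1 := pow_lt_one₀ zero_le hρ (pow_ne_zero _ two_ne_zero)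
    have h := step k' s hk hs hind hT hkL hρm ih
    rw [pow_succ, pow_mul]
    exact h

end Iteration

end MonomialDensityProof

/-! ### E. The statements -/

section Statements

open MonomialDensityProof

/-- (‡ᵇ) **Monomial density** without completeness: in a valued field `C` with values in
`ℝ≥0`, let `k'` be a trivially valued subfield and `s₁ … s_d` nonzero elements with
`ℤ`-independent values such that the subfield `k'(s)` is dense.  Then every intermediate
field `L ⊇ k'` whose value set contains each `v (s i)` is dense. -/
theorem monomialDensity (C : Type*) [Field C] [Valued C ℝ≥0]
    (k' : Subfield C) (hk : ∀ c ∈ k', c ≠ 0 → Valued.v c = 1)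
    (d : ℕ) (s : Fin d → C) (hs : ∀ i, s i ≠ 0)
    (hind : ∀ n : Fin d → ℤ, (∏ i, Valued.v (s i) ^ (n i)) = 1 → n = 0)
    (hT : Dense ((Subfield.closure ((k' : Set C) ∪ Set.range s) : Subfield C) : Set C))
    (L : Subfield C) (hkL : k' ≤ L) (hL : ∀ i, ∃ a ∈ L, Valued.v a = Valued.v (s i)) :
    Dense (L : Set C) := by
  classical
  have hsi : ∀ i, 0 < Valued.v (s i) := fun i => (Valuation.pos_iff _).mpr (hs i)
  -- START
  have hstart : ∀ i, ∃ a ∈ L, Valued.v (a - s i) < Valued.v (s i) := fun i => by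
    obtain ⟨a, haL, ha⟩ := hL i
    exact exists_close_of_same_value k' s hk hs hind hT hkL i haL ha
  choose a haL ha using hstart
  obtain ⟨ρ₀, hρ₀, hP⟩ :
      ∃ ρ₀ : ℝ≥0, ρ₀ < 1 ∧ ∀ i, ∃ b ∈ L, Valued.v (b - s i) ≤ ρ₀ * Valued.v (s i) := by
    refine ⟨Finset.univ.sup fun i => Valued.v (a i - s i) / Valued.v (s i), ?_, fun i => ?_⟩
    · refine (Finset.sup_lt_iff (by simp)).mpr fun i _ => ?_
      exact (div_lt_one₀ (hsi i)).mpr (ha i)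
    · refine ⟨a i, haL i, (div_le_iff₀ (hsi i)).mp ?_⟩
      exact Finset.le_sup (f := fun i => Valued.v (a i - s i) / Valued.v (s i))
        (Finset.mem_univ i)
  -- LIMIT: each `s i` lies in the closure of `L`
  have hmem : ∀ i, s i ∈ closure (L : Set C) := by
    intro i
    apply mem_closure_of_forall
    intro γ hγ
    obtain ⟨n, hn⟩ := NNReal.exists_pow_lt_of_lt_one (div_pos hγ (hsi i)) hρ₀
    obtain ⟨b, hbL, hb⟩ := iterate k' s hk hs hind hT hkL hρ₀ hP n i
    refine ⟨b, hbL, lt_of_le_of_lt hb ?_⟩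
    calc ρ₀ ^ (2 ^ n) * Valued.v (s i) ≤ ρ₀ ^ n * Valued.v (s i) :=
          mul_le_mul_left (pow_le_pow_of_le_one zero_le hρ₀.le n.lt_two_pow_self.le) _
      _ < γ := (lt_div_iff₀ (hsi i)).mp hn
  -- END
  have hsub : ((k' : Set C) ∪ Set.range s) ⊆ (L.topologicalClosure : Set C) := by
    rintro x (hx | ⟨i, rfl⟩)
    · exact L.le_topologicalClosure (hkL hx)
    · exact hmem i
  have hle : Subfield.closure ((k' : Set C) ∪ Set.range s) ≤ L.topologicalClosure :=
    Subfield.closure_le.mpr hsub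
  have hD : Dense (L.topologicalClosure : Set C) := hT.mono fun x hx => hle hx
  exact dense_closure.mp hD

end Statements

/-! ### F. (append v2) The approximation-form twin (tri-2 TRIAGE v12 R3: «a twin of `monomialDensity` stated directly in
approximation form over a `Valuation K ℝ≥0`» — no `Valued` instance, no topology in the statement) -/

section ApproxForm

open MonomialDensityProof

/-- **(‡ᵇ) in approximation form.** For a field `K` with a valuation `v : Valuation K ℝ≥0` (no `Valued` instance assumed), a
subfield `k'` on which `v` is trivial, nonzero `s₁ … s_d` with `ℤ`-independent values such that `k'(s)` APPROXIMATES every element of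
`K` to within every nonzero value, and an intermediate field `L ⊇ k'` attaining each `v (s i)`: `L` approximates every element of `K` to
within every nonzero value — `∀ x w, w ≠ 0 → ∃ a ∈ L, v (a - x) < v w` (the tree's `DenseAbhyankar`-style clause). Proof: equip `K`
with `Valued.mk' v` and translate both ways through `dense_iff_forall_exists_approx`. [folklore] OURS (res-type-026 after-care;
statement shape per res-L0-w41-tri-2 TRIAGE v12 R3). -/
theorem monomialDensity_approx (K : Type*) [Field K] (v : Valuation K ℝ≥0)
    (k' : Subfield K) (hk : ∀ c ∈ k', c ≠ 0 → v c = 1)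
    (d : ℕ) (s : Fin d → K) (hs : ∀ i, s i ≠ 0)
    (hind : ∀ n : Fin d → ℤ, (∏ i, v (s i) ^ (n i)) = 1 → n = 0)
    (hT : ∀ x w : K, w ≠ 0 → ∃ a ∈ Subfield.closure ((k' : Set K) ∪ Set.range s), v (a - x) < v w)
    (L : Subfield K) (hkL : k' ≤ L) (hL : ∀ i, ∃ a ∈ L, v a = v (s i)) :
    ∀ x w : K, w ≠ 0 → ∃ a ∈ L, v (a - x) < v w := by
  letI : Valued K ℝ≥0 := Valued.mk' v
  have hv : (Valued.v : Valuation K ℝ≥0) = v := rfl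
  have hT' : Dense ((Subfield.closure ((k' : Set K) ∪ Set.range s) : Subfield K) : Set K) := by
    rw [dense_iff_forall_exists_approx, hv]
    intro x w hw
    exact hT x w hw
  have hD := monomialDensity K k' (by rw [hv]; exact hk) d s hs (by rw [hv]; exact hind) hT' L hkL (by rw [hv]; exact hL)
  rw [dense_iff_forall_exists_approx, hv] at hD
  exact hD

end ApproxForm

end Summit.ResolutionOfSingularities.ResolutionOfSingularities.Cruxes.Steer.MonomialDensity
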